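import Literature.AlgebraicGeometry.AbelianSchemes.RingActionOfPointwiseIdentities
import Literature.AlgebraicGeometry.AbelianSchemes.AbelianSchemeFibreHom
import Literature.AlgebraicGeometry.AbelianSchemes.AbelianSchemeOverHomNoetherianAnyBase
import Literature.AlgebraicGeometry.AbelianSchemes.AbelianSchemeOverCommOfReduced
import Literature.AlgebraicGeometry.Motives.AlgPointsSeparate
import Literature.Geometry.Kaehler.ComplexTorusMaps
import HarnessLib

/-!
# A family of endomorphisms which READS, through complex-torus markings of the fibres, as a ring homomorphism IS a ring action

Layer `Literature/AlgebraicGeometry/AbelianSchemes`, namespace `Literature.AlgebraicGeometry.AbelianSchemes.AbelianSchemeOver`.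
THEOREMS ONLY (no definition, no named fact, no instance), sequel of ★ (B-α) `RingActionOfPointwiseIdentities`.  Cell `hodgecm-mathlib`
(D-0151), FLOOR 0, P6 «MOD», crux hLiu418 = stmt-HodgeConjecture-24832 (`--supports`): layer D1 of the E6 closer of the E-line
`Cruxes/HLiu418/Lines/F0_P6a_PELWitnessE.lean` (A-p06 (g32), `E6Closer.skeleton.v3` `exists_ringActionReading_of_reads`), stated GENERICALLY.

THE STATEMENT ([Kottwitz1992] §5 p. 390 «`ι : 𝒪_B → End(A)`»; [MumfordFogartyKirwan1994] Ch. 6 §1 Cor. 6.2; [LangeBirkenhake1992] §1.2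
Prop. 1.2.1 — the rational representation is faithful).  Let `A → S` be an abelian scheme over a locally Noetherian `S`, `O` a commutative ring
with a finite `ℤ`-basis, and `i : O → End_S(A)` ANY family of homomorphisms.  Suppose that every connected component of `S` contains a
`ℂ`-valued point `s` at which the fibre `A_s` is MARKED — an additive surjection `φ : ℂ^g∕Πℤ^{2g} ↠ A_s(ℂ)` from a complex torus (★
`ComplexTorus Ψ`) — so that each `i b` READS on the marking as the integer matrix `M b` of a RING HOMOMORPHISM `M : O →+* M_{2g}(ℤ)`:
`(i b)_s (φ t) = φ (M b · t)` (★ `ComplexTorus.mapMatrix`).  Then `i` IS a ring action of `O` on `A` (★ `RingAction`): there is `act` with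
`act.i b = i b` for all `b`.  PROOF: the structure-table identities (E-M) `i(b_l) ≫ i(b_k) = ∏_j i(b_j)^{(b_k b_l)_j}` and (E-U) hold after base
change to each marked point — both sides read, through the surjective additive `φ`, as `φ ∘ (M(·) · )` of the same matrix (`M` is a ring
homomorphism; points separate endomorphisms of the complex fibre, ★ `SchemeOver.hom_ext_of_forall_algPoints`) — hence over `S` by ★ B-α
`exists_ringAction_of_forall_exists_fieldPoint`; and `act.i b = ∏_j i(b_j)^{b_j-coordinate}` (★ `i_eq_finsetProd_zpow`) reads as `M b` too, so
`act.i b = i b` by ★ `eq_of_forall_exists_fieldPoint`.  HC_CM is proved only modulo the printed citations until rung 0 closes; this file asserts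
nothing about HC.  Presearch: the statement is the scheme-theoretic spreading of [LangeBirkenhake1992] Prop. 1.2.1 (faithfulness of `ρ_r`) by
[MumfordFogartyKirwan1994] Cor. 6.2; tree `rg 'mapMatrix' AbelianSchemes/` = ∅ (no prior junction of ★ `ComplexTorus` markings with ★ `RingAction`).

## References
* [Kottwitz1992] R. Kottwitz, *Points on some Shimura varieties over finite fields*, JAMS 5 (1992), §5 (p. 390).
* [MumfordFogartyKirwan1994] D. Mumford, J. Fogarty, F. Kirwan, *Geometric Invariant Theory*, 3rd ed. (1994), Ch. 6 §1 Cor. 6.2 (p. 116).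
* [LangeBirkenhake1992] H. Lange, Ch. Birkenhake, *Complex Abelian Varieties* (1992), §1.2 Prop. 1.2.1 (analytic and rational representations).
* [MumfordAV1970] D. Mumford, *Abelian Varieties* (1970), §4 (points separate morphisms), §19.
-/

set_option autoImplicit false

noncomputable section

open CategoryTheory CategoryTheory.Limits AlgebraicGeometry MonoidalCategory CartesianMonoidalCategory
open scoped MonObj
open Literature.Geometry.Kaehler (ComplexTorus)
open Literature.AlgebraicGeometry.Motives (AlgPoints SchemeOver)

namespace Literature.AlgebraicGeometry.AbelianSchemes

namespace AbelianSchemeOver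

/-! ## §1 Torus algebra: `mapMatrix` is a ring representation in the matrix -/

section Torus

variable {κ : Type} [Fintype κ] {E : Type} [NormedAddCommGroup E] [NormedSpace ℂ E] (Ψ : (κ → ℝ) ≃L[ℝ] E)

/-- `ρ(A B) = ρ(A) ∘ ρ(B)` on the torus. [cite: LangeBirkenhake1992, §1.1.2 (rational representation)] -/
theorem mapMatrix_mul_apply (A B : Matrix κ κ ℤ) (t : ComplexTorus Ψ) :
    ComplexTorus.mapMatrix Ψ Ψ (A * B) t = ComplexTorus.mapMatrix Ψ Ψ A (ComplexTorus.mapMatrix Ψ Ψ B t) := by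
  obtain ⟨x, rfl⟩ : ∃ x, t = ComplexTorus.proj Ψ x := ⟨ComplexTorus.lift Ψ t, (ComplexTorus.proj_lift Ψ t).symm⟩
  have hmap : (A * B).map (Int.cast : ℤ → ℝ) = A.map (Int.cast : ℤ → ℝ) * B.map (Int.cast : ℤ → ℝ) := by
    simpa only [Int.coe_castRingHom] using (Matrix.map_mul (L := A) (M := B) (f := Int.castRingHom ℝ))
  rw [ComplexTorus.mapMatrix_proj, ComplexTorus.mapMatrix_proj, ComplexTorus.mapMatrix_proj, Matrix.mulVec_mulVec, hmap]

/-- `ρ(1) = id` on the torus. [cite: LangeBirkenhake1992, §1.1.2 (rational representation)] -/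
theorem mapMatrix_one_apply [DecidableEq κ] (t : ComplexTorus Ψ) : ComplexTorus.mapMatrix Ψ Ψ (1 : Matrix κ κ ℤ) t = t := by
  obtain ⟨x, rfl⟩ : ∃ x, t = ComplexTorus.proj Ψ x := ⟨ComplexTorus.lift Ψ t, (ComplexTorus.proj_lift Ψ t).symm⟩
  rw [ComplexTorus.mapMatrix_proj, Matrix.map_one _ Int.cast_zero Int.cast_one, Matrix.one_mulVec]

/-- `ρ` is additive in the matrix: `ρ(A + B) t = ρ(A) t + ρ(B) t`. [cite: LangeBirkenhake1992, §1.1.2 (rational representation)] -/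
theorem mapMatrix_add_matrix (A B : Matrix κ κ ℤ) (t : ComplexTorus Ψ) :
    ComplexTorus.mapMatrix Ψ Ψ (A + B) t = ComplexTorus.mapMatrix Ψ Ψ A t + ComplexTorus.mapMatrix Ψ Ψ B t := by
  funext i'
  change ∑ i, (A + B) i' i • t i = (∑ i, A i' i • t i) + ∑ i, B i' i • t i
  simp only [Matrix.add_apply, add_smul, Finset.sum_add_distrib]

/-- `ρ(Σ_j c_j A_j) t = Σ_j c_j • ρ(A_j) t`. [cite: LangeBirkenhake1992, §1.1.2 (rational representation)] -/
theorem mapMatrix_sum_smul {J : Type*} (s : Finset J) (c : J → ℤ) (A : J → Matrix κ κ ℤ) (t : ComplexTorus Ψ) :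
    ComplexTorus.mapMatrix Ψ Ψ (∑ j ∈ s, c j • A j) t = ∑ j ∈ s, c j • ComplexTorus.mapMatrix Ψ Ψ (A j) t := by
  let L : Matrix κ κ ℤ →+ ComplexTorus Ψ :=
    AddMonoidHom.mk' (fun A => ComplexTorus.mapMatrix Ψ Ψ A t) (fun A B => mapMatrix_add_matrix Ψ A B t)
  change L (∑ j ∈ s, c j • A j) = ∑ j ∈ s, c j • L (A j)
  rw [map_sum]
  exact Finset.sum_congr rfl fun j _ => map_zsmul L (c j) (A j)

end Torus

/-! ## §2 Additive markings turn `ℤ`-combinations into products of powers -/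

section Marking

variable {κ : Type} [Fintype κ] {E : Type} [NormedAddCommGroup E] [NormedSpace ℂ E] {Ψ : (κ → ℝ) ≃L[ℝ] E}
  {G : Type*} [CommGroup G] (φ : ComplexTorus Ψ → G) (hφ : ∀ x y, φ (x + y) = φ x * φ y)

omit [Fintype κ] in
include hφ in
/-- An additive map `φ` from a torus to a commutative group sends `Σ_j c_j • x_j` to `∏_j φ(x_j)^{c_j}` (the exponential ∕ marking of a
complex torus is a homomorphism). [cite: LangeBirkenhake1992, §1.1 (Lemma 1.1.3) and §1.2 Prop. 1.2.1] -/
theorem marking_sum_zsmul {J : Type*} (s : Finset J) (c : J → ℤ) (x : J → ComplexTorus Ψ) :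
    φ (∑ j ∈ s, c j • x j) = ∏ j ∈ s, φ (x j) ^ c j := by
  let Φa : ComplexTorus Ψ →+ Additive G := AddMonoidHom.mk' (fun x => Additive.ofMul (φ x)) (fun x y => by
    rw [hφ]; rfl)
  have h : Φa (∑ j ∈ s, c j • x j) = ∑ j ∈ s, c j • Φa (x j) := by
    rw [map_sum]
    exact Finset.sum_congr rfl fun j _ => map_zsmul Φa (c j) (x j)
  have h' := congrArg Additive.toMul h
  rw [toMul_sum] at h'
  simp only [toMul_zsmul] at h'
  exact h'

end Marking

/-! ## §3 Readings at a marked complex point -/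

section Reading

variable {S : Scheme.{0}} {A : AbelianSchemeOver S} [IsCommMonObj A.X]
  {κ : Type} [Fintype κ] [DecidableEq κ] {E : Type} [NormedAddCommGroup E] [NormedSpace ℂ E]
  {s : Spec (.of ℂ) ⟶ S} {Ψ : (κ → ℝ) ≃L[ℝ] E}
  (φ : ComplexTorus Ψ → (A.fibre s).toAbelianVariety.Points ℂ) (hφ : ∀ x y, φ (x + y) = φ x * φ y)

omit [DecidableEq κ] in
open scoped CategoryTheory.Obj in
include hφ in
/-- **Products of powers READ as `ℤ`-combinations of matrices.**  If `y_j` reads on the additive marking `φ` as `M_j`, then `∏_j y_j^{c_j}`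
reads as `Σ_j c_j M_j`: `f ↦ (f_s)(φ t)` is a monoid homomorphism `End_S(A) → A_s(ℂ)` (base change to the point is cartesian monoidal, Mathlib
`Functor.map_mul`; evaluation at a point is multiplicative, Mathlib `MonObj.comp_mul`), and `φ ∘ ρ(·) t` is additive in the matrix (§1–§2).
[cite: LangeBirkenhake1992, §1.2 Prop. 1.2.1] [cite: Kottwitz1992, §5 (p. 390)] -/
theorem algPointsMap_pullback_map_finsetProd_zpow_marking {J : Type*} (T : Finset J) (y : J → (A.X ⟶ A.X))
    (M : J → Matrix κ κ ℤ)
    (hread : ∀ j ∈ T, ∀ t, AlgPoints.map ((Over.pullback s).map (y j)) (φ t) = φ (ComplexTorus.mapMatrix Ψ Ψ (M j) t))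
    (c : J → ℤ) (t : ComplexTorus Ψ) :
    AlgPoints.map ((Over.pullback s).map (∏ j ∈ T, y j ^ c j)) (φ t) =
      φ (ComplexTorus.mapMatrix Ψ Ψ (∑ j ∈ T, c j • M j) t) := by
  -- evaluation of the base change at the marked point, as a monoid homomorphism `End_S(A) →* A_s(ℂ)`
  let ev : (A.X ⟶ A.X) →* (A.fibre s).toAbelianVariety.Points ℂ :=
    { toFun := fun f => AlgPoints.map ((Over.pullback s).map f) (φ t)
      map_one' := by
        change φ t ≫ (Over.pullback s).map (1 : A.X ⟶ A.X) = 1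
        rw [CategoryTheory.Functor.map_one]
        exact MonObj.comp_one _
      map_mul' := fun f g => by
        change φ t ≫ (Over.pullback s).map (f * g) = (φ t ≫ (Over.pullback s).map f) * (φ t ≫ (Over.pullback s).map g)
        rw [CategoryTheory.Functor.map_mul]
        exact MonObj.comp_mul _ _ _ }
  change ev (∏ j ∈ T, y j ^ c j) = _
  rw [map_prod, mapMatrix_sum_smul, marking_sum_zsmul φ hφ]
  refine Finset.prod_congr rfl fun j hj => ?_
  rw [map_zpow, ← hread j hj]
  rfl

omit [IsCommMonObj A.X] [DecidableEq κ] in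
/-- **Two endomorphisms with the SAME matrix reading on a surjective marking agree on the fibre** (points separate morphisms of the
complex fibre, ★ `SchemeOver.hom_ext_of_forall_algPoints`). [cite: MumfordAV1970, §4] [cite: LangeBirkenhake1992, §1.2 Prop. 1.2.1] -/
theorem pullback_map_eq_of_marking_readings (hsurj : Function.Surjective φ) (f g : A.X ⟶ A.X) (Mf Mg : Matrix κ κ ℤ)
    (hf : ∀ t, AlgPoints.map ((Over.pullback s).map f) (φ t) = φ (ComplexTorus.mapMatrix Ψ Ψ Mf t))
    (hg : ∀ t, AlgPoints.map ((Over.pullback s).map g) (φ t) = φ (ComplexTorus.mapMatrix Ψ Ψ Mg t)) (hM : Mf = Mg) :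
    (Over.pullback s).map f = (Over.pullback s).map g := by
  haveI := Literature.AlgebraicGeometry.Motives.AbelianVariety.isReduced_left (A.fibre s).toAbelianVariety
  refine SchemeOver.hom_ext_of_forall_algPoints (X := (A.fibre s).toAbelianVariety.X) (Y := (A.fibre s).toAbelianVariety.X) ℂ
    fun P => ?_
  obtain ⟨t, rfl⟩ := hsurj P
  change AlgPoints.map ((Over.pullback s).map f) (φ t) = AlgPoints.map ((Over.pullback s).map g) (φ t)
  rw [hf, hg, hM]

end Reading

/-! ## §4 THE HEAD: a READ family of homomorphisms IS a ring action -/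

section Head

variable {S : Scheme.{0}} [IsLocallyNoetherian S] {A : AbelianSchemeOver S} [IsCommMonObj A.X]
  {κ : Type} [Fintype κ] [DecidableEq κ] {E : Type} [NormedAddCommGroup E] [NormedSpace ℂ E]
  {O : Type*} [CommRing O] {n : ℕ} (i : O → (A.X ⟶ A.X)) [hi : ∀ b, IsMonHom (i b)]

/-- **A FAMILY OF ENDOMORPHISMS WHICH READS, THROUGH MARKINGS OF THE COMPLEX FIBRES, AS A RING HOMOMORPHISM IS A RING ACTION**
([Kottwitz1992] §5 `ι : 𝒪_B → End(A)`; [MumfordFogartyKirwan1994] Cor. 6.2; [LangeBirkenhake1992] Prop. 1.2.1).  `A → S` an abelian scheme over a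
locally Noetherian `S`, `O` a commutative ring with a finite `ℤ`-basis, `i : O → End_S(A)` homomorphisms; if every connected component of `S`
holds a `ℂ`-valued point `s` with an additive surjective marking `φ : ComplexTorus Ψ ↠ A_s(ℂ)` and a ring homomorphism `M : O →+* M(κ, ℤ)` with
`(i b)_s (φ t) = φ (M b · t)` for all `b`, `t`, then there is `act : RingAction O A` with `act.i b = i b` for every `b ∈ O`.
[cite: Kottwitz1992, §5 (p. 390)] [cite: MumfordFogartyKirwan1994, Ch. 6 §1 Corollary 6.2 (p. 116)] [cite: LangeBirkenhake1992, §1.2 Prop. 1.2.1] -/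
theorem exists_ringAction_eq_of_forall_exists_markedReading (bs : Module.Basis (Fin n) ℤ O)
    (h : ∀ x : S, ∃ (s : Spec (.of ℂ) ⟶ S), s.base (IsLocalRing.closedPoint ℂ) ∈ connectedComponent x ∧
      ∃ (Ψ : (κ → ℝ) ≃L[ℝ] E) (φ : ComplexTorus Ψ → (A.fibre s).toAbelianVariety.Points ℂ) (M : O →+* Matrix κ κ ℤ),
        (∀ x y, φ (x + y) = φ x * φ y) ∧ Function.Surjective φ ∧
        ∀ (b : O) (t : ComplexTorus Ψ),
          AlgPoints.map ((Over.pullback s).map (i b)) (φ t) = φ (ComplexTorus.mapMatrix Ψ Ψ (M b) t)) :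
    ∃ act : RingAction O A, ∀ b, act.i b = i b := by
  classical
  -- the readings as `ℤ`-combinations along the basis
  have hcomb : ∀ (M : O →+* Matrix κ κ ℤ) (a : O), ∑ j, bs.repr a j • M (bs j) = M a := fun M a => by
    conv_rhs => rw [← bs.sum_repr a]
    rw [map_sum]
    exact Finset.sum_congr rfl fun j _ => (map_zsmul M _ _).symm
  -- (E-M) + (E-U) at the marked points, hence the action on the basis (★ B-α)
  obtain ⟨act, hact⟩ := exists_ringAction_of_forall_exists_fieldPoint bs (fun j => i (bs j)) fun x => by
    obtain ⟨s, hs, Ψ, φ, M, hφ, hsurj, hread⟩ := h x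
    refine ⟨ℂ, inferInstance, s, hs, fun k l => ?_, ?_⟩
    · refine pullback_map_eq_of_marking_readings φ hsurj _ _ (M (bs k) * M (bs l)) (∑ j, bs.repr (bs k * bs l) j • M (bs j))
        (fun t => ?_) (fun t => algPointsMap_pullback_map_finsetProd_zpow_marking φ hφ Finset.univ (fun j => i (bs j))
          (fun j => M (bs j)) (fun j _ t => hread (bs j) t) _ t) (by rw [hcomb, map_mul])
      rw [CategoryTheory.Functor.map_comp, AlgPoints.map_comp_apply, hread, hread, mapMatrix_mul_apply]
    · refine pullback_map_eq_of_marking_readings φ hsurj _ _ 1 (∑ j, bs.repr 1 j • M (bs j)) (fun t => ?_)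
        (fun t => algPointsMap_pullback_map_finsetProd_zpow_marking φ hφ Finset.univ (fun j => i (bs j))
          (fun j => M (bs j)) (fun j _ t => hread (bs j) t) _ t) (by rw [hcomb, map_one])
      rw [CategoryTheory.Functor.map_id, AlgPoints.map_id_apply, mapMatrix_one_apply]
  -- `act.i b = ∏_j i(b_j)^{b_j} = i b`: both read as `M b`
  refine ⟨act, fun b => ?_⟩
  haveI := act.isMonHom b
  refine eq_of_forall_exists_fieldPoint (act.i b) (i b) fun x => ?_
  obtain ⟨s, hs, Ψ, φ, M, hφ, hsurj, hread⟩ := h x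
  refine ⟨ℂ, inferInstance, s, hs, ?_⟩
  refine pullback_map_eq_of_marking_readings φ hsurj _ _ (∑ j, bs.repr b j • M (bs j)) (M b) (fun t => ?_) (hread b) (hcomb M b)
  have hb : act.i b = ∏ j, i (bs j) ^ bs.repr b j := by
    rw [i_eq_finsetProd_zpow bs act b]
    exact Finset.prod_congr rfl fun j _ => by rw [hact j]
  rw [hb]
  exact algPointsMap_pullback_map_finsetProd_zpow_marking φ hφ Finset.univ (fun j => i (bs j)) (fun j => M (bs j))
    (fun j _ t => hread (bs j) t) _ t

end Head

end AbelianSchemeOver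

end Literature.AlgebraicGeometry.AbelianSchemes

end
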